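import Summits.ResolutionOfSingularities.ResolutionOfSingularities.Theorems.WildTwistedToricLU5
import Summits.ResolutionOfSingularities.ResolutionOfSingularities.Theorems.InvariantDescentLU2
import Summits.ResolutionOfSingularities.ResolutionOfSingularities.Theorems.TameTwoStoreyLU2
import HarnessLib

/-!
# WildTwistedToricLU (6/7) — THE LAW of the unlucky binomial log-diagonal wild kind `λ′`

Node «TwistedToricCut» (decomp-res lens-1 g33), tree file 6/7.

`relLU_of_wildLogDiagonalUnluckyAbove : WildLogDiagonalUnluckyAbove k O → RelLocalUniformization k K O` —
hypothesis-free, every `d`, every `p`, on the landed kind `λ′` (`WildLogDiagonalLU4`) VERBATIM.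

Proof = Galois frame exactly as g31's `WildReflectionLU2.relLU_of_wildPseudoReflectionLUAbove` (finite frame
`Gfin`, fixed field `ι(K)` by `IsGalois`, `σ = g`, `σ^p = 1`, `g ≠ 1` BECAUSE a twisted coordinate is moved —
`one_add_zpow_ne_one`, `p = char k` USED — so `E^σ = ι(K)` by `mem_powers_of_prime_card`); the frame's action on
the r.s.p. `x = x′^A` is `σ xᵢ = xᵢ (1 + η)^{(A·N)ᵢ}`; NORM ONE from the moved coordinate (file 3); THE ENGINE
(file 5) gives `y ⊆ ι(K) ∩ O′` with `(M ∩ ι(K))[y]` regular at the centre; Artin–Tate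
(`InvariantDescentLU2.exists_finset_inf_fixed_eq_closure`) writes `M ∩ ι(K) = ι(R)[t]`; `TameTwoStoreyLU2.relLU_transport`
descends `ι(R)[t ∪ y]` to `K`.  HONEST SCOPE: the two-pivot kind `λ″ = WildLogDiagonalMixedAbove` is not touched.
-/

noncomputable section

open IsLocalRing Polynomial IntermediateField Literature.AlgebraicGeometry.Resolution
open Summit.ResolutionOfSingularities.ResolutionOfSingularities.Theorems.InvariantDescentLU
open Summit.ResolutionOfSingularities.ResolutionOfSingularities.Theorems.InertDescentLU
open Summit.ResolutionOfSingularities.ResolutionOfSingularities.Theorems.WildReflectionLU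
open Summit.ResolutionOfSingularities.ResolutionOfSingularities.Theorems.WildLogDiagonalLU
open Summit.ResolutionOfSingularities.ResolutionOfSingularities.Theorems.TameQuotientLU
open Summit.ResolutionOfSingularities.ResolutionOfSingularities.Theorems.TameAbelianQuotientLU
open Summit.ResolutionOfSingularities.ResolutionOfSingularities.Theorems.TameTwoStoreyLU

universe u

namespace Summit.ResolutionOfSingularities.ResolutionOfSingularities.Theorems.WildTwistedToricLU

section Closure

variable {E : Type u} [Field E]

/-- `closure (closure s ∪ u) = closure (s ∪ u)`. [folklore] -/
theorem closure_closure_union (s u : Set E) :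
    Subring.closure (((Subring.closure s : Subring E) : Set E) ∪ u) = Subring.closure (s ∪ u) := by
  apply le_antisymm
  · refine Subring.closure_le.mpr (Set.union_subset ?_ fun z hz => Subring.subset_closure (Or.inr hz))
    exact Subring.closure_le.mpr fun z hz => Subring.subset_closure (Or.inl hz)
  · exact Subring.closure_mono (Set.union_subset_union_left u Subring.subset_closure)

end Closure

section Law

variable (k : Type) [Field k] {K : Type} [Field K] [Algebra k K]

variable {k}

set_option maxHeartbeats 1600000 in
/-- **THE LAW OF THE UNLUCKY BINOMIAL LOG-DIAGONAL WILD KIND `λ′`** (hypothesis-free, every `d`, every `p`):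
`WildLogDiagonalUnluckyAbove k O → RelLocalUniformization k K O`, by the Frobenius/Hilbert-90-twisted toric
quotient (files 1–5).  Consumed: the r.s.p. clauses, the factorisation `x = x′^A` (to move the action to `x`),
the twist clause with `x′ⱼ ≠ 0` and `∃ Nⱼ ≠ 0` (for `g ≠ 1` and NORM ONE), the pivot clause (for `η ∈ 𝔪 ∖ 0`),
residues in `k`, `([K′:K] : k) = 0` (for `CharP`).  NOT used: any luckiness / principality.
[this node; cites: KiralyLutkebohmert2013 Ex. 6, Rem. 3; CossartPiltant2008 Lemma 9.4; Fulton1993Toric §2.6] -/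
theorem relLU_of_wildLogDiagonalUnluckyAbove {O : ValuationSubring K} (h : WildLogDiagonalUnluckyAbove k O) :
    RelLocalUniformization k K O := by
  classical
  obtain ⟨K', hfd, hgal, hprime, hchar, O', hO'O, hGO', hκ', hLU⟩ := h
  haveI := hfd
  haveI := hgal
  intro R hRfg hRfrac hRO
  haveI := hRfrac
  obtain ⟨t₀, hMO, hGM, hMreg, d, x, x', A, η, w, a', g, N, hdim, hx, hgen, hx', hmon, hpiv, htw, j₁, hj₁⟩ :=
    hLU R hRfg hRfrac hRO
  obtain ⟨hηM, hηv, hwB, hwv, hηeq⟩ := hpiv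
  -- the prime `p = [K′ : K] = char k = char K′`
  set p : ℕ := Module.finrank K K' with hpdef
  haveI hpF : Fact p.Prime := ⟨hprime⟩
  haveI : CharP k p := ringChar.of_eq (CharP.ringChar_of_prime_eq_zero hprime hchar)
  haveI : CharP K' p := charP_of_injective_algebraMap (algebraMap k K').injective p
  have hpE : (p : K') = 0 := CharP.cast_eq_zero K' p
  let ι : K →+* K' := (algebraMap K K' : K →+* K')
  have hgf : ∀ (g : K' ≃ₐ[K] K') (x : K), g (ι x) = ι x := fun g x => g.commutes x
  have hfk : ∀ c : k, ι (algebraMap k K c) = algebraMap k K' c := fun c =>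
    (IsScalarTower.algebraMap_apply k K K' c).symm
  -- the finite frame `Gfin ⊆ K′ ≃+* K′`, fixed field `ι(K)`
  let Gfin : Finset (K' ≃+* K') := Finset.univ.image fun g : K' ≃ₐ[K] K' => (g : K' ≃+* K')
  have hGfin : ∀ g' ∈ Gfin, ∃ g : K' ≃ₐ[K] K', (g : K' ≃+* K') = g' := fun g' hg' => by
    obtain ⟨g, -, hg⟩ := Finset.mem_image.mp hg'
    exact ⟨g, hg⟩
  have hmemGfin : ∀ g : K' ≃ₐ[K] K', (g : K' ≃+* K') ∈ Gfin := fun g =>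
    Finset.mem_image.mpr ⟨g, Finset.mem_univ _, rfl⟩
  have hcoe1 : ((1 : K' ≃ₐ[K] K') : K' ≃+* K') = 1 := RingEquiv.ext fun _ => rfl
  have hcoemul : ∀ g g' : K' ≃ₐ[K] K', ((g * g' : K' ≃ₐ[K] K') : K' ≃+* K') =
      (g : K' ≃+* K') * (g' : K' ≃+* K') := fun _ _ => RingEquiv.ext fun _ => rfl
  have hcoepow : ∀ (g : K' ≃ₐ[K] K') (n : ℕ), ((g ^ n : K' ≃ₐ[K] K') : K' ≃+* K') = (g : K' ≃+* K') ^ n := by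
    intro g n
    induction n with
    | zero => rw [pow_zero, pow_zero, hcoe1]
    | succ n ih => rw [pow_succ, pow_succ, hcoemul, ih]
  have h1G : (1 : K' ≃+* K') ∈ Gfin := hcoe1 ▸ hmemGfin 1
  have hmulG : ∀ a ∈ Gfin, ∀ b ∈ Gfin, a * b ∈ Gfin := by
    intro a ha b hb
    obtain ⟨g, rfl⟩ := hGfin a ha
    obtain ⟨g', rfl⟩ := hGfin b hb
    rw [← hcoemul]
    exact hmemGfin _
  let Kfix : Subfield K' := ι.fieldRange
  have hKfix : ∀ z : K', z ∈ Kfix ↔ ∀ h ∈ Gfin, h z = z := by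
    intro z
    constructor
    · intro hz h hh
      obtain ⟨x, rfl⟩ := RingHom.mem_fieldRange.mp hz
      obtain ⟨g, rfl⟩ := hGfin h hh
      exact hgf g x
    · intro hz
      obtain ⟨x, hx⟩ := exists_algebraMap_eq_of_fixed_all (K := K) fun g => hz _ (hmemGfin g)
      exact RingHom.mem_fieldRange.mpr ⟨x, hx⟩
  have hHO : ∀ h ∈ Gfin, ∀ z : K', z ∈ O' ↔ h z ∈ O' := by
    intro h hh z
    obtain ⟨g, rfl⟩ := hGfin h hh
    exact hGO' g z
  -- the model `M = ι(R)[t₀]` over the constants `S′ = ι(R)`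
  set S' : Subring K' := R.toSubring.map ι with hS'def
  set M : Subring K' := modelAbove k R K' t₀ with hMdef
  have hMgen : M = Subring.closure ((S' : Set K') ∪ (t₀ : Set K')) := rfl
  have hS'M : S' ≤ M := fun w hw => Subring.subset_closure (Or.inl hw)
  have hRS : ∀ x ∈ R, ι x ∈ S' := fun x hx => Subring.mem_map.mpr ⟨x, hx, rfl⟩
  have hS'K : S' ≤ Kfix.toSubring := by
    rintro w hw
    obtain ⟨x, -, rfl⟩ := Subring.mem_map.mp hw
    exact RingHom.mem_fieldRange.mpr ⟨x, rfl⟩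
  have hkS : ∀ c : k, algebraMap k K' c ∈ S' := fun c => by
    rw [← hfk]; exact hRS _ (R.algebraMap_mem c)
  have hMH : ∀ h ∈ Gfin, ∀ z ∈ M, h z ∈ M := by
    intro h hh z hz
    obtain ⟨g, rfl⟩ := hGfin h hh
    exact hGM g z hz
  haveI : Algebra.FiniteType k R := (Subalgebra.fg_iff_finiteType R).mp hRfg
  haveI : IsNoetherianRing R := Algebra.FiniteType.isNoetherianRing k R
  haveI hS'noeth : IsNoetherianRing S' :=
    isNoetherianRing_of_surjective R S' (ι.restrict R S' hRS) (by
      rintro ⟨w, hw⟩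
      obtain ⟨x, hx, rfl⟩ := Subring.mem_map.mp hw
      exact ⟨⟨x, hx⟩, rfl⟩)
  have hSuc : IsUniversallyCatenaryRing S' :=
    (isUniversallyCatenaryRing_of_finiteType_field k R).of_surjective (ι.restrict R S' hRS) (by
      rintro ⟨y, hy⟩
      obtain ⟨z, hz, rfl⟩ := Subring.mem_map.mp hy
      exact ⟨⟨z, hz⟩, rfl⟩)
  have hresO : ∀ y ∈ O', ∃ c ∈ S', O'.valuation (y - c) < 1 := fun y hy => by
    obtain ⟨c, hc⟩ := hκ' y hy
    exact ⟨algebraMap k K' c, hkS c, (O'.mem_nonunits_iff).mp hc⟩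
  -- the pivot unit and the moved coordinate: `η ≠ 0`, `g ≠ 1`
  have hηB : η ∈ locAtCentre M O' := le_locAtCentre M O' hηM
  have hη0 : η ≠ 0 := by
    rw [hηeq]
    exact mul_ne_zero (ne_zero_of_valuation_eq_one hwv)
      (Finset.prod_ne_zero_iff.mpr fun j _ => pow_ne_zero _ (hx' j).1)
  have hg1 : g ≠ 1 := by
    rintro rfl
    have e : x' j₁ = x' j₁ * (1 + η) ^ N j₁ := by rw [← htw j₁]; rfl
    have h1 : (1 + η) ^ N j₁ = 1 := mul_left_cancel₀ (hx' j₁).1 (e.symm.trans (mul_one (x' j₁)).symm)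
    exact one_add_zpow_ne_one O' p (hMO hηM) hηv hη0 hj₁ h1
  -- the datum `σ = g`: `σ^p = 1`, `E^σ = ι(K)`
  set σ : K' ≃+* K' := (g : K' ≃+* K') with hσdef
  have hσG : σ ∈ Gfin := hmemGfin g
  have hσO : ∀ z : K', z ∈ O' ↔ σ z ∈ O' := hGO' g
  have hcard : Nat.card (K' ≃ₐ[K] K') = p := IsGalois.card_aut_eq_finrank K K'
  have hσp : σ ^ p = 1 := by
    have hgp : g ^ p = 1 := by rw [← hcard]; exact pow_card_eq_one'
    rw [hσdef, ← hcoepow, hgp, hcoe1]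
  have hfixall : ∀ z : K', g z = z → ∀ g' : K' ≃ₐ[K] K', g' z = z := by
    intro z hz g'
    obtain ⟨m, rfl⟩ := (Submonoid.mem_powers_iff _ _).mp (mem_powers_of_prime_card hcard hg1 (g' := g'))
    induction m with
    | zero => rw [pow_zero, AlgEquiv.one_apply]
    | succ m ih => rw [pow_succ, AlgEquiv.mul_apply, hz]; exact ih
  have hσK : ∀ z : K', σ z = z → z ∈ Kfix := fun z hz =>
    (hKfix z).mpr fun h hh => by
      obtain ⟨g', rfl⟩ := hGfin h hh
      exact hfixall z hz g'
  -- the frame action on the r.s.p.: `σ xᵢ = xᵢ (1 + η)^{(A·N)ᵢ}`; NORM ONE from the moved coordinate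
  have hU0 : (1 + η) ≠ 0 := ne_zero_of_valuation_eq_one (valuation_one_add_eq_one O' hηv)
  let N' : Fin d → ℤ := fun i => ∑ j, N j * (A i j : ℤ)
  have hσx : ∀ i, σ (x i) = x i * (1 + η) ^ N' i := by
    intro i
    rw [hmon i, map_prod, ← prod_zpow_eq_zpow_sum₀ hU0, ← Finset.prod_mul_distrib]
    refine Finset.prod_congr rfl fun j _ => ?_
    rw [map_pow, show σ (x' j) = x' j * (1 + η) ^ N j from htw j, mul_pow, ← zpow_natCast ((1 + η) ^ N j),
      ← zpow_mul]
  have hx0 : ∀ i, x i ≠ 0 := fun i => by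
    rw [hmon i]; exact Finset.prod_ne_zero_iff.mpr fun j _ => pow_ne_zero _ (hx' j).1
  have hnorm : ∏ i ∈ Finset.range p, (σ ^ i) (1 + η) = 1 :=
    norm_eq_one O' p hσO hσp hηv (hx' j₁).1 hj₁ (htw j₁)
  -- the invariant model is Noetherian and universally catenary at the centre (Artin–Tate)
  haveI : IsNoetherianRing (M ⊓ Kfix.toSubring : Subring K') :=
    isNoetherianRing_inf_fixed Gfin Kfix M h1G hmulG hKfix hMH S' hS'K t₀ hMgen
  obtain ⟨t, htsub, hteq⟩ := exists_finset_inf_fixed_eq_closure Gfin Kfix M h1G hmulG hKfix hMH S' hS'K t₀ hMgen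
  have hTO : Subring.closure ((S' : Set K') ∪ (t : Set K')) ≤ O'.toSubring := by
    rw [← hteq]; exact inf_le_left.trans hMO
  have hAuc : IsUniversallyCatenaryRing (locAtCentre (M ⊓ Kfix.toSubring) O') := by
    rw [hteq]; exact isUniversallyCatenaryRing_locAtCentre_closure O' S' hSuc t hTO
  -- THE ENGINE
  obtain ⟨y, hyK, hyO, hreg⟩ := exists_twisted_toric_chart O' p hpE h1G hmulG hKfix hHO hMO hMH hMreg hAuc
    S' hS'K hS'M t₀ hMgen hresO hσG hσp hσK hx hx0 hgen hdim ⟨hηB, hηv⟩ hη0 N' hσx hnorm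
  -- transport `ι(R)[t ∪ y]` down to `K`
  have ht_sub : ((t ∪ y : Finset K') : Set K') ⊆ Set.range ι := by
    intro z hz
    rw [Finset.coe_union] at hz
    rcases hz with hz | hz
    · exact RingHom.mem_fieldRange.mp (Subring.mem_inf.mp (htsub hz)).2
    · exact RingHom.mem_fieldRange.mp (hyK hz)
  have hcl : Subring.closure ((S' : Set K') ∪ ((t ∪ y : Finset K') : Set K')) =
      Subring.closure (((M ⊓ Kfix.toSubring : Subring K') : Set K') ∪ (y : Set K')) := by
    rw [hteq, closure_closure_union, Finset.coe_union, Set.union_assoc]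
  have hTO' : Subring.closure ((S' : Set K') ∪ ((t ∪ y : Finset K') : Set K')) ≤ O'.toSubring := by
    rw [hcl]
    refine Subring.closure_le.mpr (Set.union_subset (inf_le_left.trans hMO) fun z hz => hyO z hz)
  have hTreg : IsRegularLocalRing (locAtCentre (Subring.closure
      ((S' : Set K') ∪ ((t ∪ y : Finset K') : Set K'))) O') := by
    rw [hcl]; exact hreg
  exact relLU_transport hO'O hRfg (t ∪ y) ht_sub hTO' hTreg

/-- Fully-qualified audit example: the law decides the landed kind `λ′` verbatim. -/
example {O : ValuationSubring K}
    (h : Summit.ResolutionOfSingularities.ResolutionOfSingularities.Theorems.WildLogDiagonalLU.WildLogDiagonalUnluckyAbove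
      k O) :
    Literature.AlgebraicGeometry.Resolution.RelLocalUniformization k K O :=
  relLU_of_wildLogDiagonalUnluckyAbove h

/-- Control: composed with the landed inclusion `cell ⊆ λ′` (`WildLogDiagonalLU4`), the law re-decides g32's LUCKY
binomial cell WITHOUT its luckiness clause. -/
example {O : ValuationSubring K} (h : WildLogDiagonalLUAbove k O) : RelLocalUniformization k K O :=
  relLU_of_wildLogDiagonalUnluckyAbove (wildLogDiagonalUnluckyAbove_of_wildLogDiagonalLUAbove h)

end Law

end Summit.ResolutionOfSingularities.ResolutionOfSingularities.Theorems.WildTwistedToricLU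

end
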